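import Mathlib
import Literature.Geometry.DiscreteGeometry.LayerShells
import Summits.NavierStokesRegularity.NavierStokesRegularity.Theorems.ThreadingFluxHorizonTowerDefs
import HarnessLib

/-!
# Crux `PoloidalLiouville` (stmt-NavierStokesRegularity-1222, wall W1), crux idea «horizon-threading-tower» (ns-idea-15):
# ALL-DEGREE horizon zonality, kernel part F1 — THE ISOTROPIC AXIS (memo Lemma F)

Support file (Theorems-side tooling; seat ns-wall-eng-5 g4, cell ns-wall-extremal, W1 adjunct; `--supports stmt-NavierStokesRegularity-1222
--as helper`).  Memo of record: pub/ns-wall-extremal/ARM-B/zonal-eng5/PROOF-HZSD-ALL-L.md (DATUM B-w5.8; critic-replicated, ns-wall-crit-1 g2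
2026-08-28T22:52:10Z), §3.  Content:

* `eval_smul_of_isHomogeneous` — `p(c·z) = c^l p(z)` for a homogeneous polynomial;
* `isoVec s t = (s² − t², i(s² + t²), 2st)` — the null-conic chart of `ℂ³` (`isoVec_sq_sum`: `Σ εᵢ² = 0`);
* ★ `exists_isoVec_root` (Lemma F): **every complex form of degree `l ≥ 1` on `ℂ³` vanishes at a non-zero isotropic vector** — the chart
  `t ↦ p(ε(1,t))` is a one-variable polynomial (`chartT`); if non-constant it has a root (`Complex.exists_root`, FTA); if constant `= c`,
  either `c = 0` or homogeneity gives `p(ε(s,1)) = c·s^{2l}` off `s = 0`, hence as polynomials (`Polynomial.eq_of_infinite_eval_eq`), so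
  `p(ε(0,1)) = 0`;
* ★ `exists_orthonormal_isotropic_zero` (real form): **for a real form `p` of degree `l ≥ 1` on ℝ³ there are orthonormal `u ⊥ v` with
  `p_ℂ(u + i v) = 0`** (real/imaginary parts of an isotropic zero have equal norms and are orthogonal; rescale by homogeneity).

By memo Lemma E this is an axis (`u × v`) about which `p` has no sectoral (weight-`l`) component.  Pure algebra (+ FTA from Mathlib); no NS
statement.  HONEST LABEL: tooling toward the crux-idea obstruction `HorizonZonalitySingleDegree` (all `l`); that statement (until the assembly
lands), `PoloidalLiouville` (1222), `UnthreadedRigidity` (27585) and NS regularity remain OPEN; W1/W2 movement 0.  [folklore]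
-/

-- the summit and its single problem share the name (D-0017 nested layout)
set_option linter.dupNamespace false

noncomputable section

open MvPolynomial Complex
open scoped RealInnerProductSpace
open Literature.Geometry.DiscreteGeometry (inner_fin3 norm_sq_fin3)

namespace Summit.NavierStokesRegularity.NavierStokesRegularity.Theorems.PoloidalLiouville.HorizonTower.Zonal

/-! ### Homogeneous polynomials scale -/

/-- Scaling of a homogeneous polynomial under dilation of the argument: `p(c·z) = c^l p(z)`. [folklore] -/
theorem eval_smul_of_isHomogeneous {K : Type*} [CommRing K] {σ : Type*} {p : MvPolynomial σ K} {l : ℕ}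
    (hp : p.IsHomogeneous l) (c : K) (z : σ → K) : eval (fun i => c * z i) p = c ^ l * eval z p := by
  classical
  rw [eval_eq, eval_eq, Finset.mul_sum]
  refine Finset.sum_congr rfl fun d hd => ?_
  have hdeg : ∑ i ∈ d.support, d i = l := (hp.degree_eq_sum_deg_support hd).symm
  rw [Finset.prod_congr rfl (fun i _ => mul_pow c (z i) (d i)), Finset.prod_mul_distrib, Finset.prod_pow_eq_pow_sum,
    hdeg]
  ring

/-! ### The null conic parametrisation -/

/-- The isotropic vectors `ε(s,t) = (s² − t², i(s² + t²), 2st)` (a parametrisation of the null cone `ε·ε = 0` of `ℂ³`). -/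
def isoVec (s t : ℂ) : Fin 3 → ℂ := ![s ^ 2 - t ^ 2, I * (s ^ 2 + t ^ 2), 2 * s * t]

/-- First coordinate of the chart. [folklore] -/
@[simp] theorem isoVec_zero (s t : ℂ) : isoVec s t 0 = s ^ 2 - t ^ 2 := rfl
/-- Second coordinate of the chart. [folklore] -/
@[simp] theorem isoVec_one (s t : ℂ) : isoVec s t 1 = I * (s ^ 2 + t ^ 2) := rfl
/-- Third coordinate of the chart. [folklore] -/
@[simp] theorem isoVec_two (s t : ℂ) : isoVec s t 2 = 2 * s * t := rfl

/-- `ε(s,t)` is isotropic: `Σ εᵢ² = 0`. -/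
theorem isoVec_sq_sum (s t : ℂ) : isoVec s t 0 ^ 2 + isoVec s t 1 ^ 2 + isoVec s t 2 ^ 2 = 0 := by
  simp only [isoVec_zero, isoVec_one, isoVec_two]
  have : I ^ 2 = -1 := I_sq
  linear_combination (s ^ 2 + t ^ 2) ^ 2 * this

/-- `ε(s,t) = 0` only for `(s,t) = 0`: here the two charts we use, `(1,t)` and `(0,1)`, are non-zero. -/
theorem isoVec_one_ne_zero (t : ℂ) : isoVec 1 t ≠ 0 := by
  intro h
  have h0 := congrFun h 0
  have h1 := congrFun h 1
  simp only [isoVec_zero, isoVec_one, Pi.zero_apply, one_pow, mul_eq_zero, I_ne_zero, false_or] at h0 h1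
  have : (2 : ℂ) = 0 := by linear_combination h0 + h1
  norm_num at this

/-- Dilating the chart: `ε(s, 1) = s² · ε(1, 1/s)` for `s ≠ 0`. -/
theorem isoVec_scale {s : ℂ} (hs : s ≠ 0) (i : Fin 3) : isoVec s 1 i = s ^ 2 * isoVec 1 s⁻¹ i := by
  fin_cases i <;> simp <;> field_simp

/-! ### One-variable restrictions -/

/-- The polynomial `t ↦ p_ℂ(ε(1,t))`. -/
def chartT (p : MvPolynomial (Fin 3) ℂ) : Polynomial ℂ :=
  aeval ![(1 : Polynomial ℂ) - Polynomial.X ^ 2, Polynomial.C I * (1 + Polynomial.X ^ 2), 2 * Polynomial.X] p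

/-- The polynomial `s ↦ p_ℂ(ε(s,1))`. -/
def chartS (p : MvPolynomial (Fin 3) ℂ) : Polynomial ℂ :=
  aeval ![Polynomial.X ^ 2 - 1, Polynomial.C I * (Polynomial.X ^ 2 + 1), 2 * Polynomial.X] p

/-- `chartT p` evaluates to `p(ε(1,t))`. [folklore] -/
theorem eval_chartT (p : MvPolynomial (Fin 3) ℂ) (t : ℂ) : (chartT p).eval t = eval (isoVec 1 t) p := by
  rw [chartT, ← Polynomial.coe_aeval_eq_eval, ← AlgHom.comp_apply, MvPolynomial.comp_aeval]
  rw [show (eval (isoVec 1 t)) p = aeval (isoVec 1 t) p from rfl]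
  congr 2
  funext i
  fin_cases i <;> simp [isoVec]

/-- `chartS p` evaluates to `p(ε(s,1))`. [folklore] -/
theorem eval_chartS (p : MvPolynomial (Fin 3) ℂ) (s : ℂ) : (chartS p).eval s = eval (isoVec s 1) p := by
  rw [chartS, ← Polynomial.coe_aeval_eq_eval, ← AlgHom.comp_apply, MvPolynomial.comp_aeval]
  rw [show (eval (isoVec s 1)) p = aeval (isoVec s 1) p from rfl]
  congr 2
  funext i
  fin_cases i <;> simp [isoVec]

/-- **Lemma F (isotropic zero).**  A complex form of degree `l ≥ 1` on `ℂ³` vanishes at some non-zero isotropic vector of the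
family `ε(s,t)`. [folklore] (binary form of degree `2l` on the null conic; fundamental theorem of algebra) -/
theorem exists_isoVec_root (p : MvPolynomial (Fin 3) ℂ) {l : ℕ} (hp : p.IsHomogeneous l) (hl : 1 ≤ l) :
    ∃ s t : ℂ, isoVec s t ≠ 0 ∧ eval (isoVec s t) p = 0 := by
  by_cases hG : 0 < (chartT p).degree
  · -- the chart `t ↦ p(ε(1,t))` is non-constant: FTA
    obtain ⟨t₀, ht₀⟩ := Complex.exists_root hG
    refine ⟨1, t₀, isoVec_one_ne_zero t₀, ?_⟩
    rw [← eval_chartT]; exact ht₀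
  · -- the chart is constant `= p(1, i, 0)`
    have hc : chartT p = Polynomial.C ((chartT p).coeff 0) := Polynomial.eq_C_of_degree_le_zero (not_lt.mp hG)
    set c := (chartT p).coeff 0 with hcdef
    have hconst : ∀ t, eval (isoVec 1 t) p = c := by
      intro t; rw [← eval_chartT, hc, Polynomial.eval_C]
    by_cases hc0 : c = 0
    · refine ⟨1, 0, isoVec_one_ne_zero 0, ?_⟩
      rw [hconst, hc0]
    · -- then `s ↦ p(ε(s,1)) = c s^{2l}` off `s = 0`, hence everywhere, so `p(ε(0,1)) = 0`
      have hS : ∀ s : ℂ, s ≠ 0 → (chartS p).eval s = (Polynomial.C c * Polynomial.X ^ (2 * l)).eval s := by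
        intro s hs
        rw [eval_chartS, Polynomial.eval_mul, Polynomial.eval_C, Polynomial.eval_pow, Polynomial.eval_X]
        have h1 : isoVec s 1 = fun i => s ^ 2 * isoVec 1 s⁻¹ i := funext (isoVec_scale hs)
        rw [h1, eval_smul_of_isHomogeneous hp, hconst, pow_mul]; ring
      have heq : chartS p = Polynomial.C c * Polynomial.X ^ (2 * l) := by
        apply Polynomial.eq_of_infinite_eval_eq
        apply Set.Infinite.mono (s := {x : ℂ | x ≠ 0})
        · intro x hx; exact hS x hx
        · exact (Set.finite_singleton (0 : ℂ)).infinite_compl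
      refine ⟨0, 1, ?_, ?_⟩
      · intro h
        have := congrFun h 0
        simp [isoVec] at this
      · rw [← eval_chartS, heq]
        simp [Polynomial.eval_pow, show 2 * l ≠ 0 by omega]

/-! ### From an isotropic zero to an orthonormal pair -/

/-- Real and imaginary parts of an isotropic vector `ε = a + ib ≠ 0`: `|a| = |b| ≠ 0` and `a ⊥ b`. -/
theorem re_im_of_isoVec (s t : ℂ) :
    (∑ i : Fin 3, ((isoVec s t i).re) ^ 2) = (∑ i : Fin 3, ((isoVec s t i).im) ^ 2)
      ∧ (∑ i : Fin 3, (isoVec s t i).re * (isoVec s t i).im) = 0 := by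
  have h := isoVec_sq_sum s t
  have hre := congrArg Complex.re h
  have him := congrArg Complex.im h
  simp only [Fin.sum_univ_three]
  simp only [add_re, add_im, zero_re, zero_im, pow_two, mul_re, mul_im] at hre him
  constructor
  · linarith
  · linarith

/-- **Lemma F, real form.**  For a real form `p` of degree `l ≥ 1` on ℝ³ there is an orthonormal pair `u ⊥ v` with
`p_ℂ(u + i v) = 0`. [folklore] -/
theorem exists_orthonormal_isotropic_zero (p : MvPolynomial (Fin 3) ℝ) {l : ℕ} (hp : p.IsHomogeneous l) (hl : 1 ≤ l) :
    ∃ u v : E3, ‖u‖ = 1 ∧ ‖v‖ = 1 ∧ ⟪u, v⟫ = 0 ∧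
      eval (fun i => ((u i : ℝ) : ℂ) + ((v i : ℝ) : ℂ) * I) (map (algebraMap ℝ ℂ) p) = 0 := by
  obtain ⟨s, t, hne, hroot⟩ := exists_isoVec_root (map (algebraMap ℝ ℂ) p) (hp.map _) hl
  -- real and imaginary parts
  set a : E3 := WithLp.toLp 2 (fun i => (isoVec s t i).re) with ha
  set b : E3 := WithLp.toLp 2 (fun i => (isoVec s t i).im) with hb
  obtain ⟨hsq, horth⟩ := re_im_of_isoVec s t
  have ha2 : ‖a‖ ^ 2 = ∑ i : Fin 3, ((isoVec s t i).re) ^ 2 := by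
    rw [norm_sq_fin3, Fin.sum_univ_three]
  have hb2 : ‖b‖ ^ 2 = ∑ i : Fin 3, ((isoVec s t i).im) ^ 2 := by
    rw [norm_sq_fin3, Fin.sum_univ_three]
  have hab : ⟪a, b⟫ = 0 := by
    rw [inner_fin3]; simp only [Fin.sum_univ_three] at horth; simpa [ha, hb] using horth
  have hnorm : ‖a‖ = ‖b‖ := by
    have : ‖a‖ ^ 2 = ‖b‖ ^ 2 := by rw [ha2, hb2, hsq]
    exact (sq_eq_sq₀ (norm_nonneg _) (norm_nonneg _)).mp this
  have hdecomp : ∀ i, isoVec s t i = (((a : E3) i : ℝ) : ℂ) + (((b : E3) i : ℝ) : ℂ) * I := by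
    intro i; simp [ha, hb, re_add_im]
  have hapos : 0 < ‖a‖ := by
    by_contra hle
    push Not at hle
    have ha0 : a = 0 := norm_eq_zero.mp (le_antisymm hle (norm_nonneg _))
    have hb0 : b = 0 := by rw [← norm_eq_zero, ← hnorm]; exact norm_eq_zero.mpr ha0
    apply hne
    funext i
    rw [hdecomp i, ha0, hb0]
    simp
  refine ⟨‖a‖⁻¹ • a, ‖a‖⁻¹ • b, ?_, ?_, ?_, ?_⟩
  · rw [norm_smul, norm_inv, norm_norm, inv_mul_cancel₀ hapos.ne']
  · rw [norm_smul, norm_inv, norm_norm, hnorm, ← hnorm, inv_mul_cancel₀ hapos.ne']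
  · rw [inner_smul_left, inner_smul_right, hab]; simp
  · -- `p_ℂ((a + ib)/‖a‖) = ‖a‖^{-l} p_ℂ(ε) = 0`
    have hfun : (fun i => (((‖a‖⁻¹ • a : E3) i : ℝ) : ℂ) + (((‖a‖⁻¹ • b : E3) i : ℝ) : ℂ) * I)
        = fun i => ((‖a‖⁻¹ : ℝ) : ℂ) * isoVec s t i := by
      funext i
      rw [hdecomp i, PiLp.smul_apply, PiLp.smul_apply, smul_eq_mul, smul_eq_mul, ofReal_mul, ofReal_mul]
      ring
    rw [hfun, eval_smul_of_isHomogeneous (hp.map _), hroot, mul_zero]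

end Summit.NavierStokesRegularity.NavierStokesRegularity.Theorems.PoloidalLiouville.HorizonTower.Zonal

end
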